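import Literature.AlgebraicGeometry.HodgeTheory.EllipticCurvePowersHodgeClasses
import Mathlib.LinearAlgebra.ExteriorPower.Basis
import HarnessLib

/-!
# The cup-monomial bases of `H•(B)` for `B` with slots over an elliptic curve: increasing monomials in the letters
# `g_i^* v_ℓ`, rational when `v` is, the sign rule for arbitrary words, and the SLOT SHAPE of the coordinates of a word monomial

Family `hodge`, layer `Literature/AlgebraicGeometry/HodgeTheory`. Written for the cell `pub-hodgeav-hg6` (LADDER-HodgeAV row 2,
TABLE X row 21 `g6.E3xY3.(2,1)`, census programme γ2, brick γ2-D(ii) «`S`-side, Künneth basis», eng-2 g6; honest framing of that cell: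
HC / HC_AV / HC_CM NOT proved — THIS file is UNCONDITIONAL linear algebra on the tree's carriers). Theorems only (no definition, no
named fact, D-0026; nothing admitted).

For `B` with an `E`-slot structure `g : Fin n → (B ⟶ E)` (`EllSlots E B g`, e.g. `E³ = E.powSucc 2`) and a basis `v` of `H¹(E(ℂ); ℂ)`
the `2n` letters `g_i^* v_ℓ` form a basis of `H¹(B)` (`EllSlots.slotBasis`); since `H•(B) = ⋀• H¹(B)`
(`Motives.abelianVarietyCohomologyExteriorH1_holds`), the INCREASING cup monomials in these letters (ordered through
`finProdFinEquiv : Fin n × Fin 2 ≃ Fin (n·2)`), indexed by the `k`-subsets `s` of `Fin (n·2)`, form a basis of `Hᵏ(B)` for every `k`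
(Mathlib's `Module.Basis.exteriorPower` transported along the comparison isomorphism):

* `EllSlots.exists_cupMonomialBasis` — existence of the family of bases `b k`, `b k s = ⌣_{j ∈ s↑} (g v)_j`;
* `isRationalClass_cupMonomialBasis` — the `b k s` are rational classes when `v₀, v₁` are;
* `cupPowOneAlt_word_eq_sign_smul_cupMonomialBasis` — for an INJECTIVE word `w` (no repeated letter) the monomial `(g v)_w` is
  `± b k (letters of w)`;
* `blockCount_eq_slotCount_of_repr_cupPowOneAlt_ne_zero` — for ANY pair of letters `v'` of `H¹(E)` and any word `w`, the
  coordinates of the monomial `(g v')_w` along `b k` are supported on the subsets `s` with the same SLOT SHAPE as `w`: for every slot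
  `a`, `#{j ∈ s : slot j = a} = #{t : slot (w t) = a}` (letter base change is slot by slot, `slotLetters_baseChange`);
* `cupMonomialBasis_std_two_one`, `blockCount_std_two_one` — the basis vectors of shape `(2,1)` at `(a, b′)`: the subset of the word
  `((a,0),(a,1),(b′,r))` is `± (g_a^*v₀ ⌣ g_a^*v₁) ⌣ g_{b′}^* v_r`, has that shape, and `r ↦` subset is injective.

These are the `S`-side inputs (`S = E³`) of the Künneth-coefficient bookkeeping of the codimension-three census of `T × E³`
(Moonen–Zarhin 1999 Thm. 0.2 (1)).

## Sources

* [LangeBirkenhake1992] H. Lange, Ch. Birkenhake, *Complex Abelian Varieties* (1992), Lemma 1.1.17, Exercise 1.1.6 (7), Thm. 4.2.1.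
* [Greub1978Multilinear] W. Greub, *Multilinear Algebra*, 2nd ed. (1978), §5.7 (5.12)–(5.13) (bases of `⋀ᵏ`).
* [FultonYoungTableaux1997] W. Fulton, *Young Tableaux* (1997), §8.1.
* [Gordon1997] B. B. Gordon, A survey of the Hodge conjecture for abelian varieties, arXiv:alg-geom/9709030, §3 (Murasaki's basis).
* [HatcherAT2002] A. Hatcher, *Algebraic Topology* (2002), §3.1, §3.2.
-/

noncomputable section

open CategoryTheory
open Literature.AlgebraicTopology.SingularHomology
open Literature.AlgebraicGeometry.Motives (IsSmoothProjective AbelianVariety)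
open Literature.Barriers.HodgeConjecture
open Literature.NumberTheory.DiophantineGeometry
open Literature.RepresentationTheory.GeneralLinear

namespace Literature.AlgebraicGeometry.HodgeTheory

section MonomialBasis

variable {E B : AbelianVariety ℂ} {n : ℕ} {g : Fin n → (B ⟶ E)}

/-- **The increasing cup monomials in the letters `g_i^* v_ℓ` form bases of the `Hᵏ(B(ℂ); ℂ)`** (`H• = ⋀• H¹`, Lange–Birkenhake
Exercise 1.1.6 (7); the basis `e_{j₁} ∧ ⋯ ∧ e_{j_k}`, `j₁ < ⋯ < j_k`, of `⋀ᵏ`, Greub (5.12)): there is a family of bases `b k` of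
`Hᵏ(B)`, indexed by the `k`-subsets `s` of `Fin (n·2)`, with `b k s = (g v)_{j₁} ⌣ ⋯ ⌣ (g v)_{j_k}` for `j₁ < ⋯ < j_k` the elements
of `s` and `(g v)_j = g_i^* v_ℓ`, `(i, ℓ) = finProdFinEquiv⁻¹ j`. [cite: LangeBirkenhake1992, Exercise 1.1.6 (7) and Lemma 1.1.17]
[cite: Greub1978Multilinear, §5.7 (5.12)] -/
theorem EllSlots.exists_cupMonomialBasis (hg : EllSlots E B g) (v : Module.Basis (Fin 2) ℂ (complexBetti E.X 1)) :
    ∃ b : (k : ℕ) → Module.Basis (Set.powersetCard (Fin (n * 2)) k) ℂ (complexBetti B.X k),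
      ∀ (k : ℕ) (s : Set.powersetCard (Fin (n * 2)) k),
        b k s = cupPowOne ℂ (Motives.ComplexPoints B.X) k
          (fun i => slotLetters g v (finProdFinEquiv.symm (s.val.orderEmbOfFin s.prop i))) := by
  let Λ : Module.Basis (Fin (n * 2)) ℂ (complexBetti B.X 1) := (hg.slotBasis v).reindex finProdFinEquiv
  have h := Motives.abelianVarietyCohomologyExteriorH1_holds
  refine ⟨fun k => (Λ.exteriorPower k).map (h.equiv B k), fun k s => ?_⟩
  rw [Module.Basis.map_apply, exteriorPower.basis_apply]
  change h.equiv B k (exteriorPower.ιMulti ℂ k (⇑Λ ∘ (Set.powersetCard.ofFinEmbEquiv.symm s))) = _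
  rw [Motives.abelianVarietyCohomologyExteriorH1.equiv_ιMulti]
  congr 1
  funext i
  simp only [Function.comp_apply, Set.powersetCard.ofFinEmbEquiv_symm_apply, Λ, Module.Basis.reindex_apply,
    EllSlots.coe_slotBasis]

/-- **The monomial bases consist of rational classes** when `v₀, v₁` are rational. [cite: HatcherAT2002, §3.1 p. 198 and §3.2 Prop. 3.10] -/
theorem isRationalClass_cupMonomialBasis {v : Module.Basis (Fin 2) ℂ (complexBetti E.X 1)} (hv : ∀ ℓ, IsRationalClass (v ℓ))
    (b : (k : ℕ) → Module.Basis (Set.powersetCard (Fin (n * 2)) k) ℂ (complexBetti B.X k))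
    (hb : ∀ (k : ℕ) (s : Set.powersetCard (Fin (n * 2)) k), b k s = cupPowOne ℂ (Motives.ComplexPoints B.X) k
      (fun i => slotLetters g v (finProdFinEquiv.symm (s.val.orderEmbOfFin s.prop i))))
    (k : ℕ) (s : Set.powersetCard (Fin (n * 2)) k) : IsRationalClass (b k s) := by
  rw [hb]
  exact isRationalClass_cupPowOne k _ fun i => isRationalClass_slotLetters g hv _

/-- **The sign rule**: for a word `w` WITHOUT repeated letters, the monomial `(g v)_w` is `sign(σ) · b k (letters of w)`, `σ` the
permutation sorting `w` (`e_{w} = ε_σ e_{sorted w}` in `⋀ᵏ`). [cite: Greub1978Multilinear, §5.7 (5.12)–(5.13)] [cite: FultonYoungTableaux1997, §8.1] -/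
theorem cupPowOneAlt_word_eq_sign_smul_cupMonomialBasis (v : Module.Basis (Fin 2) ℂ (complexBetti E.X 1))
    (b : (k : ℕ) → Module.Basis (Set.powersetCard (Fin (n * 2)) k) ℂ (complexBetti B.X k))
    (hb : ∀ (k : ℕ) (s : Set.powersetCard (Fin (n * 2)) k), b k s = cupPowOne ℂ (Motives.ComplexPoints B.X) k
      (fun i => slotLetters g v (finProdFinEquiv.symm (s.val.orderEmbOfFin s.prop i))))
    {k : ℕ} (w : Fin k → Fin n × Fin 2) (hw : Function.Injective w) :
    ∃ (σ : Equiv.Perm (Fin k)) (hcard : (Finset.univ.image (finProdFinEquiv ∘ w)).card = k),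
      cupPowOneAlt ℂ (Motives.ComplexPoints B.X) k (slotLetters g v ∘ w) =
        (((Equiv.Perm.sign σ : ℤˣ) : ℤ) : ℂ) • b k (Set.powersetCard.ofCard hcard) := by
  classical
  have hinj : Function.Injective (finProdFinEquiv ∘ w) := finProdFinEquiv.injective.comp hw
  have hcard : (Finset.univ.image (finProdFinEquiv ∘ w)).card = k := by
    rw [Finset.card_image_of_injective _ hinj, Finset.card_univ, Fintype.card_fin]
  set s := Finset.univ.image (finProdFinEquiv ∘ w) with hs
  set e := s.orderEmbOfFin hcard with he
  have hmem : ∀ t, ∃ i, e i = finProdFinEquiv (w t) := fun t => by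
    have ht : finProdFinEquiv (w t) ∈ Set.range e := by
      rw [he, Finset.range_orderEmbOfFin]
      exact Finset.mem_coe.2 (Finset.mem_image_of_mem _ (Finset.mem_univ t))
    exact ht
  choose σ hσ using hmem
  have hσinj : Function.Injective σ := by
    intro t t' htt'
    apply hinj
    change finProdFinEquiv (w t) = finProdFinEquiv (w t')
    rw [← hσ t, ← hσ t', htt']
  set τ : Equiv.Perm (Fin k) := Equiv.ofBijective σ (Finite.injective_iff_bijective.1 hσinj) with hτ
  refine ⟨τ, hcard, ?_⟩
  have hcomp : slotLetters g v ∘ w = (fun i => slotLetters g v (finProdFinEquiv.symm (e i))) ∘ τ := by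
    funext t
    simp only [Function.comp_apply, hτ, Equiv.ofBijective_apply, hσ, Equiv.symm_apply_apply]
  rw [hcomp, AlternatingMap.map_perm, Units.smul_def, Int.cast_smul_eq_zsmul, cupPowOneAlt_apply, hb]
  rfl

/-- The monomial of a word with a repeated letter vanishes; otherwise the sign rule applies: in either case the coordinates of
`(g v)_w` along `b k` vanish off the subset of letters of `w`. [cite: Greub1978Multilinear, §5.7 (5.12)–(5.13)] -/
theorem repr_cupPowOneAlt_word_eq_zero_of_ne (v : Module.Basis (Fin 2) ℂ (complexBetti E.X 1))
    (b : (k : ℕ) → Module.Basis (Set.powersetCard (Fin (n * 2)) k) ℂ (complexBetti B.X k))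
    (hb : ∀ (k : ℕ) (s : Set.powersetCard (Fin (n * 2)) k), b k s = cupPowOne ℂ (Motives.ComplexPoints B.X) k
      (fun i => slotLetters g v (finProdFinEquiv.symm (s.val.orderEmbOfFin s.prop i))))
    {k : ℕ} (w : Fin k → Fin n × Fin 2) (s : Set.powersetCard (Fin (n * 2)) k)
    (hs : s.val ≠ Finset.univ.image (finProdFinEquiv ∘ w)) :
    (b k).repr (cupPowOneAlt ℂ (Motives.ComplexPoints B.X) k (slotLetters g v ∘ w)) s = 0 := by
  classical
  by_cases hw : Function.Injective w
  · obtain ⟨σ, hcard, hval⟩ := cupPowOneAlt_word_eq_sign_smul_cupMonomialBasis v b hb w hw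
    rw [hval, map_smul, Finsupp.smul_apply, Module.Basis.repr_self, Finsupp.single_eq_of_ne, smul_zero]
    intro h
    apply hs
    rw [h]
    rfl
  · obtain ⟨t, t', hww, htt'⟩ := Function.not_injective_iff.1 hw
    rw [(cupPowOneAlt ℂ (Motives.ComplexPoints B.X) k).map_eq_zero_of_eq (slotLetters g v ∘ w)
      (by simp only [Function.comp_apply, hww]) htt', map_zero, Finsupp.zero_apply]

/-- **The coordinates of a word monomial have the word's SLOT SHAPE.** For any two letters `v'₀, v'₁ ∈ H¹(E)` and any word `w`,
if the coordinate of `(g v')_w` along `b k` at the subset `s` is non-zero, then for every slot `a` the number of elements of `s` in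
slot `a` equals the number of positions of `w` in slot `a` (expand `v'_ℓ = Σ_j G_{jℓ} v_j` slot by slot, `slotLetters_baseChange`,
multilinearly: `(g v')_w` is a combination of the `(g v)_{w'}` with `w'` of the same slots; each is `0` or `±` a basis vector with
those slots). [cite: FultonYoungTableaux1997, §8.1] [cite: Greub1978Multilinear, §5.7 (5.12)] -/
theorem blockCount_eq_slotCount_of_repr_cupPowOneAlt_ne_zero (v : Module.Basis (Fin 2) ℂ (complexBetti E.X 1))
    (b : (k : ℕ) → Module.Basis (Set.powersetCard (Fin (n * 2)) k) ℂ (complexBetti B.X k))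
    (hb : ∀ (k : ℕ) (s : Set.powersetCard (Fin (n * 2)) k), b k s = cupPowOne ℂ (Motives.ComplexPoints B.X) k
      (fun i => slotLetters g v (finProdFinEquiv.symm (s.val.orderEmbOfFin s.prop i))))
    (v' : Fin 2 → complexBetti E.X 1) {k : ℕ} (w : Fin k → Fin n × Fin 2) (s : Set.powersetCard (Fin (n * 2)) k)
    (hs : (b k).repr (cupPowOneAlt ℂ (Motives.ComplexPoints B.X) k (slotLetters g v' ∘ w)) s ≠ 0) (a : Fin n) :
    (s.val.filter fun j => (finProdFinEquiv.symm j).1 = a).card = (Finset.univ.filter fun t => (w t).1 = a).card := by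
  classical
  set F := cupPowOneAlt ℂ (Motives.ComplexPoints B.X) k with hF
  -- expand the letters `v'` in the basis `v`, slot by slot
  have hbc : ∀ il : Fin n × Fin 2, slotLetters g v' il = ∑ j, v.repr (v' il.2) j • slotLetters g v (il.1, j) := by
    rintro ⟨i, l⟩
    exact slotLetters_baseChange g (fun j l => v.repr (v' l) j) (fun l => by
      conv_lhs => rw [← v.sum_repr (v' l)]) i l
  have hexp : F (slotLetters g v' ∘ w) =
      ∑ c : Fin k → Fin 2, (∏ t, v.repr (v' (w t).2) (c t)) • F (slotLetters g v ∘ fun t => ((w t).1, c t)) := by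
    have hx : slotLetters g v' ∘ w = fun t => ∑ j, v.repr (v' (w t).2) j • slotLetters g v ((w t).1, j) :=
      funext fun t => hbc (w t)
    rw [hx, hF, cupPowOneAlt_apply, MultilinearMap.map_sum (cupPowOne ℂ (Motives.ComplexPoints B.X) k)
      (fun t j => v.repr (v' (w t).2) j • slotLetters g v ((w t).1, j))]
    refine Finset.sum_congr rfl fun c _ => ?_
    rw [MultilinearMap.map_smul_univ]
    rfl
  -- some colouring contributes: its word has the letters `s`
  have hex : ∃ c : Fin k → Fin 2, s.val = Finset.univ.image (finProdFinEquiv ∘ fun t => ((w t).1, c t)) := by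
    by_contra hnone
    push Not at hnone
    apply hs
    rw [hexp, map_sum, Finsupp.finsetSum_apply]
    refine Finset.sum_eq_zero fun c _ => ?_
    rw [map_smul, Finsupp.smul_apply, repr_cupPowOneAlt_word_eq_zero_of_ne v b hb _ s (hnone c), smul_zero]
  obtain ⟨c, hc⟩ := hex
  -- that word is injective (a `k`-subset has `k` elements), so block counts are slot counts
  have hinj : Function.Injective (finProdFinEquiv ∘ fun t => ((w t).1, c t)) := by
    have hInjOn : Set.InjOn (finProdFinEquiv ∘ fun t => ((w t).1, c t)) ↑(Finset.univ : Finset (Fin k)) :=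
      Finset.card_image_iff.1 (by rw [← hc, Finset.card_univ, Fintype.card_fin]; exact s.prop)
    intro t t' h
    exact hInjOn (Finset.mem_coe.2 (Finset.mem_univ t)) (Finset.mem_coe.2 (Finset.mem_univ t')) h
  rw [hc, Finset.filter_image, Finset.card_image_of_injective _ hinj]
  congr 1
  ext t
  simp only [Finset.mem_filter, Finset.mem_univ, true_and, Function.comp_apply, Equiv.symm_apply_apply]

/-- **The standard word of shape `(2,1)` at `(a, b′)`**, `((a,0),(a,1),(b′,r))`, has no repeated letter. [cite: FultonYoungTableaux1997, §8.1] -/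
theorem stdWord_two_one_injective {a b' : Fin n} (hab : a ≠ b') (r : Fin 2) :
    Function.Injective (![(a, 0), (a, 1), (b', r)] : Fin 3 → Fin n × Fin 2) := by
  intro i j hij
  have h3 : ∀ i : Fin 3, i = 0 ∨ i = 1 ∨ i = 2 := by intro i; fin_cases i <;> simp
  have hv0 : (![(a, 0), (a, 1), (b', r)] : Fin 3 → Fin n × Fin 2) 0 = (a, 0) := rfl
  have hv1 : (![(a, 0), (a, 1), (b', r)] : Fin 3 → Fin n × Fin 2) 1 = (a, 1) := rfl
  have hv2 : (![(a, 0), (a, 1), (b', r)] : Fin 3 → Fin n × Fin 2) 2 = (b', r) := rfl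
  have h01 : (0 : Fin 2) ≠ 1 := by decide
  rcases h3 i with rfl | rfl | rfl <;> rcases h3 j with rfl | rfl | rfl
  · rfl
  · exact absurd (Prod.mk_inj.1 (hv0.symm.trans (hij.trans hv1))).2 h01
  · exact absurd (Prod.mk_inj.1 (hv0.symm.trans (hij.trans hv2))).1 hab
  · exact absurd (Prod.mk_inj.1 (hv1.symm.trans (hij.trans hv0))).2 h01.symm
  · rfl
  · exact absurd (Prod.mk_inj.1 (hv1.symm.trans (hij.trans hv2))).1 hab
  · exact absurd (Prod.mk_inj.1 (hv2.symm.trans (hij.trans hv0))).1 (Ne.symm hab)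
  · exact absurd (Prod.mk_inj.1 (hv2.symm.trans (hij.trans hv1))).1 (Ne.symm hab)
  · rfl

/-- The letters of the standard word `((a,0),(a,1),(b′,r))` form a `3`-subset. [cite: FultonYoungTableaux1997, §8.1] -/
theorem card_image_stdWord_two_one {a b' : Fin n} (hab : a ≠ b') (r : Fin 2) :
    (Finset.univ.image (finProdFinEquiv ∘ (![(a, 0), (a, 1), (b', r)] : Fin 3 → Fin n × Fin 2))).card = 3 := by
  rw [Finset.card_image_of_injective _ (finProdFinEquiv.injective.comp (stdWord_two_one_injective hab r)),
    Finset.card_univ, Fintype.card_fin]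

/-- **The basis vector of the standard word of shape `(2,1)`**: `b 3 {(a,0),(a,1),(b′,r)} = ± (g_a^*v₀ ⌣ g_a^*v₁) ⌣ g_{b′}^*v_r`.
[cite: Greub1978Multilinear, §5.7 (5.12)–(5.13)] [cite: HatcherAT2002, §3.2 Prop. 3.10] -/
theorem cupMonomialBasis_std_two_one (v : Module.Basis (Fin 2) ℂ (complexBetti E.X 1))
    (b : (k : ℕ) → Module.Basis (Set.powersetCard (Fin (n * 2)) k) ℂ (complexBetti B.X k))
    (hb : ∀ (k : ℕ) (s : Set.powersetCard (Fin (n * 2)) k), b k s = cupPowOne ℂ (Motives.ComplexPoints B.X) k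
      (fun i => slotLetters g v (finProdFinEquiv.symm (s.val.orderEmbOfFin s.prop i))))
    {a b' : Fin n} (hab : a ≠ b') (r : Fin 2) :
    ∃ ε : ℤ, (ε = 1 ∨ ε = -1) ∧
      b 3 (Set.powersetCard.ofCard (card_image_stdWord_two_one hab r)) =
        (ε : ℂ) • cupProduct (show 2 + 1 = 3 by norm_num)
          (cupProduct (show 1 + 1 = 2 by norm_num) (slotLetters g v (a, 0)) (slotLetters g v (a, 1))) (slotLetters g v (b', r)) := by
  obtain ⟨σ, hcard, hval⟩ := cupPowOneAlt_word_eq_sign_smul_cupMonomialBasis v b hb _ (stdWord_two_one_injective hab r)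
  refine ⟨((Equiv.Perm.sign σ : ℤˣ) : ℤ), ?_, ?_⟩
  · rcases Int.units_eq_one_or (Equiv.Perm.sign σ) with h | h
    · exact Or.inl (by rw [h]; rfl)
    · exact Or.inr (by rw [h]; rfl)
  · -- `ε² = 1`: move the sign to the other side
    have hεsq : ((((Equiv.Perm.sign σ : ℤˣ) : ℤ) : ℂ)) * (((Equiv.Perm.sign σ : ℤˣ) : ℤ) : ℂ) = 1 := by
      rw [← Int.cast_mul, ← Units.val_mul, Int.units_mul_self, Units.val_one, Int.cast_one]
    have hmono : cupPowOneAlt ℂ (Motives.ComplexPoints B.X) 3 (slotLetters g v ∘ ![(a, 0), (a, 1), (b', r)]) =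
        cupProduct (show 2 + 1 = 3 by norm_num)
          (cupProduct (show 1 + 1 = 2 by norm_num) (slotLetters g v (a, 0)) (slotLetters g v (a, 1))) (slotLetters g v (b', r)) := by
      rw [cupPowOneAlt_apply]
      change cupPowOne ℂ _ (1 + 1 + 1) _ = _
      rw [cupPowOne_succ, cupPowOne_succ, cupPowOne_one,
        ← cupProduct_assoc (show 1 + 1 = 2 by norm_num) (show 1 + 1 = 2 by norm_num) (show 2 + 1 = 3 by norm_num)
          (show 1 + 2 = 3 by norm_num)]
      rfl
    have h := hval
    rw [hmono] at h
    have hcast : Set.powersetCard.ofCard hcard = Set.powersetCard.ofCard (card_image_stdWord_two_one hab r) := rfl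
    rw [← hcast, h, smul_smul, hεsq, one_smul]

/-- The standard subset of shape `(2,1)` at `(a, b′)` has `2` letters in slot `a`, `1` in slot `b′` and none elsewhere.
[cite: FultonYoungTableaux1997, §8.1] -/
theorem blockCount_std_two_one {a b' : Fin n} (hab : a ≠ b') (r : Fin 2) (c : Fin n) :
    ((Finset.univ.image (finProdFinEquiv ∘ (![(a, 0), (a, 1), (b', r)] : Fin 3 → Fin n × Fin 2))).filter
      fun j => (finProdFinEquiv.symm j).1 = c).card = if c = a then 2 else if c = b' then 1 else 0 := by
  classical
  rw [Finset.filter_image, Finset.card_image_of_injective _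
    (finProdFinEquiv.injective.comp (stdWord_two_one_injective hab r))]
  have hv0 : (![(a, 0), (a, 1), (b', r)] : Fin 3 → Fin n × Fin 2) 0 = (a, 0) := rfl
  have hv1 : (![(a, 0), (a, 1), (b', r)] : Fin 3 → Fin n × Fin 2) 1 = (a, 1) := rfl
  have hv2 : (![(a, 0), (a, 1), (b', r)] : Fin 3 → Fin n × Fin 2) 2 = (b', r) := rfl
  have hset : (Finset.univ.filter fun t : Fin 3 =>
      (finProdFinEquiv.symm ((finProdFinEquiv ∘ (![(a, 0), (a, 1), (b', r)] : Fin 3 → Fin n × Fin 2)) t)).1 = c) =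
      Finset.univ.filter fun t : Fin 3 => ((![(a, 0), (a, 1), (b', r)] : Fin 3 → Fin n × Fin 2) t).1 = c := by
    congr 1; ext t; simp only [Function.comp_apply, Equiv.symm_apply_apply]
  rw [hset]
  have huniv : (Finset.univ : Finset (Fin 3)) = {0, 1, 2} := by decide
  rw [huniv, Finset.filter_insert, Finset.filter_insert, Finset.filter_singleton, hv0, hv1, hv2]
  dsimp only
  by_cases hca : c = a
  · subst hca
    have hbc : ¬ b' = c := fun h => hab h.symm
    rw [if_pos rfl, if_pos rfl, if_neg hbc, if_pos rfl]
    decide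
  · have hac : ¬ a = c := fun h => hca h.symm
    rw [if_neg hac, if_neg hac, if_neg hca]
    by_cases hcb : c = b'
    · subst hcb
      rw [if_pos rfl, if_pos rfl]; rfl
    · have hbc : ¬ b' = c := fun h => hcb h.symm
      rw [if_neg hbc, if_neg hcb]; rfl

/-- The two standard subsets of shape `(2,1)` at `(a, b′)` (`r = 0, 1`) are distinct. [cite: FultonYoungTableaux1997, §8.1] -/
theorem stdSubset_two_one_injective {a b' : Fin n} (hab : a ≠ b') :
    Function.Injective fun r : Fin 2 => (Set.powersetCard.ofCard (card_image_stdWord_two_one hab r) :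
      Set.powersetCard (Fin (n * 2)) 3) := by
  classical
  intro r r' h
  have h' := congrArg Subtype.val h
  change Finset.univ.image (finProdFinEquiv ∘ (![(a, 0), (a, 1), (b', r)] : Fin 3 → Fin n × Fin 2)) =
    Finset.univ.image (finProdFinEquiv ∘ (![(a, 0), (a, 1), (b', r')] : Fin 3 → Fin n × Fin 2)) at h'
  have hmem : finProdFinEquiv (b', r) ∈
      Finset.univ.image (finProdFinEquiv ∘ (![(a, 0), (a, 1), (b', r')] : Fin 3 → Fin n × Fin 2)) := by
    rw [← h']
    exact Finset.mem_image.2 ⟨2, Finset.mem_univ _, rfl⟩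
  obtain ⟨t, -, ht⟩ := Finset.mem_image.1 hmem
  have ht' := finProdFinEquiv.injective ht
  have h3 : t = 0 ∨ t = 1 ∨ t = 2 := by fin_cases t <;> simp
  rcases h3 with rfl | rfl | rfl
  · exact absurd (Prod.mk_inj.1 ht').1 hab
  · exact absurd (Prod.mk_inj.1 ht').1 hab
  · exact ((Prod.mk_inj.1 ht').2).symm

end MonomialBasis

end Literature.AlgebraicGeometry.HodgeTheory

end
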